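import Summits.MatrixMultiplication.MatrixMultiplication.Theorems.AbelianSTPPCensusTB2StatDefs

/-!
# T_B static certificate, orders `5001 … 5215` (theory's t*-indexed linear checker at `τ = 2375/1000`): kernel evaluation, the domination checks, volumes `5100 … 5215`

Cell mm-stpp (rung F-M1), tier T_B = «beat `2.375` (Coppersmith–Winograd)»; checker in `AbelianSTPPCensusTB2StatDefs.lean`, table in `AbelianSTPPCensusTB2StatData.lean`
(pattern: theory g12's `AbelianSTPPCensusTAStatCDom*.lean`).  `decide` with kernel reduction (standard axioms; no `native_decide`), `Elab.async false`;
consumed by `TB2Stat.checkV_sound` / `TB2Stat.domV_sound` in the leaf `AbelianSTPPCensusLeafTB5215Closed.lean`.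
the domination checks, volumes `5100 … 5215` THIS IS NOT: arithmetic on shape lists only; no statement about STPP families or `ω`.
-/

set_option linter.dupNamespace false
set_option autoImplicit false
set_option Elab.async false

namespace Summit.MatrixMultiplication.MatrixMultiplication.Theorems.TB2Stat

set_option maxHeartbeats 0 in
/-- Domination chunk: every sorted candidate shape of the volumes `5100 … 5215` is dominated by the table (152 shapes). [original] -/
theorem dom5100 : TB2Stat.domV 116 5100 = true := by decide +kernel

end Summit.MatrixMultiplication.MatrixMultiplication.Theorems.TB2Stat
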